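import Literature.MathematicalPhysics.QuantumFieldTheory.Balaban1983to89.B5Eq117CompositionV1

/-!
# `Balaban1983to89.B5Eq119GaussianV1` — T. Bałaban, *Propagators and renormalization transformations for lattice gauge
theories. I*, Commun. Math. Phys. **95** (1984) 17–40 [Balaban1984PropagatorsI]: the GAUSSIAN CLOSED FORM (1.14) p. 19 and (1.19) p. 20 —
`((ST)^k e^{−S})(B) = Z_{k,Ax} exp(−½⟨B, Δ_kB⟩)` with `Δ_k` EXPLICIT and `Z_{k,Ax} = Z^{(k−1)}⋯Z^{(0)}` — PROVED on the V1 lattice calculus,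
for the transformation of record `B5Eq112RenormTransf.renormTransf` and its iterate `B5Eq117CompositionV1.rtPow`

statement-level skeleton of published theorems with citation tags; proofs where landed; nothing here is a claim about the Yang–Mills mass gap

PDF held: `paper:balaban1984-cmp95-propagators-rt-i` (journal page = PDF page + 16); pp. 19–20 [PDF 3–4] read for this file from the
text layer (`lit read … --pages 3-4`).

PRINT, verbatim.  p. 19: "The integral in (1.12) is obviously a Gaussian integral. We will prove later that the quadratic form
`⟨∂A, ∂A⟩` is positive on the subspace of `A` satisfying `QA = 0`, `A(Γ_{y,x}) = 0`, `x ∈ B(y)`, `y ∈ T^{(1)}_L`. A result of the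
integration is obviously a Gaussian density `(Te^{−S})(B) = Z^{(0)} exp(−½⟨B, Δ₁B⟩) = Z^{(0)} exp(−S₁(B))`. (1.14)".
p. 20: "We define `((ST)^k e^{−S})(B) = Z_{k,Ax} exp(−½⟨B, Δ_kB⟩)`. (1.19)  It is easily seen that `Z_{k,Ax} = Z^{(k−1)}·…·Z^{(0)}`,
where `Z^{(j)}` is a normalization factor connected with `j + 1` integration."

CITATION HEADER (lean-in-tree rule) — WHAT IS REPRODUCED.  Phase-2 proof file of the lit-balaban typed skeleton (HOME
`run/shared/lean/pub/lit-balaban/`), seat p38 (gen 2): SKELETON.md rows `B5.Eq1.12-1.14` (member (1.14)), `B5.Eq1.14`, `B5.Eq1.19`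
and the knitting row `B5.Eq1.16-1.19` (member (1.19)); fold owner r02, whose TORUS-carrier statements/proofs of record are
`B5SectBStatements.Eq114`/`Eq119` and `B5Eq114Gauss.eq114_holds`/`eq119_holds` (`Delta1 = W^†W`, `DeltaK = W_k^†W_k`,
`W_k = (1 − R_k)σ^k𝒯∘sec_k`).  THIS FILE IS THE V1-CARRIER TWIN: everything is over the carriers OF RECORD of `LatticeFieldCalculus`
(`Setup.Params`, `VecField P j ℝ`, the abelian action (1.3)/(1.5) `curlAction w c`), the (1.12) transformation OF RECORD
`B5Eq112RenormTransf.renormTransf` (seat p16, which flags "DELIBERATELY NOT HERE: the Gaussian evaluation (1.14)"), its iterate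
`B5Eq117CompositionV1.rtPow` = `(ST)^k` and the `k`-fold fibre integral `multiRT` with the composition law (1.17) `eq117_curlAction`
(this seat), the Euclidean plaquette space and `∂` with the volume weight `BIJ85AxialPropagator411.PlaqSpace`/`toE`/`curlOp`, the
completing-the-square identity `gaussian_source` and `formInv = (S^*S)⁻¹` (seat p09), and the absence of zero modes of `∂` on the
constraint subspace `BIJ85NoZeroModes309Torus.hD_holds` (seat p33) — all BY NAME, nothing re-declared.
TYPED READING.  `⟨B, Δ_kB⟩` is the unit-lattice pairing `Σ_b B(b)(Δ_kB)(b)` of level-`k` bond fields (`dotProduct`; the fields `B` of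
(1.19) live on the unit lattice `T_1^{(k)}` after the rescaling `S`), `Δ_k` a real symmetric MATRIX on `PBond P k` (`DeltaK`, the Gram
matrix `W_k^†W_k` of the explicit linear map `W_k = (1 − R_k)·√w∂∘faceFieldIter k`, `R_k` = orthogonal projection onto the curvatures
of the fibre directions — the same formula as the torus `B5Eq114Gauss.Wk`); `Z_{k,Ax}` is BY DEFINITION the value `((ST)^k e^{−S})(0)`
(`zAx` — what (1.19) forces at `B = 0`, where the exponential factor is `1`), and `Z^{(j)} = ((ST)e^{−½⟨·, Δ_j·⟩})(0)` (`zFactor`, "the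
normalization factor connected with `j + 1` integration", likewise read off at `B = 0`).
WHAT IS PROVED (kernel; standard axioms; standing range `k ≤ m + K`; `w > 0`, lattice factor `c ≠ 0`):
**(1.19)** `eq119`: `((ST)^k e^{−S})(B) = Z_{k,Ax}·exp(−½⟨B, Δ_kB⟩)` for EVERY `B`, `Z_{k,Ax} > 0` (`zAx_pos`), `Δ_k` symmetric and
non-negative (`DeltaK_isSymm`, `DeltaK_nonneg`, `⟨B, Δ_kB⟩ = ‖W_kB‖²`); **(1.14)** `eq114` (`k = 1`, for `renormTransf` itself, `Z^{(0)} = zAx 1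
= zFactor 0`); **"`Z_{k,Ax} = Z^{(k−1)}⋯Z^{(0)}`"** `zAx_eq_prod`, with the one-step Gaussian recursion behind it
`((ST)e^{−½⟨·,Δ_k·⟩})(B) = Z^{(k)}exp(−½⟨B, Δ_{k+1}B⟩)` (`eq119_step`) and `Z^{(k)} > 0` (`zFactor_pos`); and the level-`0` consistency
`⟨B, Δ₀B⟩ = 2S(B)` (`dotProduct_DeltaK_zero`).  The proof IS the printed one ("obviously a Gaussian integral"): on the fibre
`faceFieldIter k B + constraint411 k` the exponent is `½‖S_ku + s_k(B)‖²` (`S_k` = curvature of the fibre directions, injective by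
`hD_holds`; `s_k(B)` = curvature of the section), completing the square (`gaussian_source`) leaves `exp(−½‖(1 − R_k)s_k(B)‖²)` times the
`B`-independent Gaussian constant, and `R_k s = S_k(S_k^*S_k)⁻¹S_k^* s` (least squares, `projK_apply_eq`).
DELIBERATELY NOT HERE: the bounds (1.67) on `Δ_k` (Sect. F), the Landau-gauge representation of `Δ_k` (Sect. C–E), the torus↔V1 dictionary.

Unit `lit-balaban-p38` (literature-prover-lit-balaban-p38-g2-0), 2026-08-21.

v1.1 (same day, append-only): §4 = **(1.15) ITERATED on V1** — p. 19: "The form `⟨B, Δ₁B⟩` is gauge invariant" — for every `k`: the one-step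
covariance of seat p16 (`B5Eq112RenormTransf.renormTransf_gaugeShift`, block-constant `λ`) in density form (`rtDensity_gaugeShift`) iterated along
`(ST)^k` (`rtPow_gaugeShift`: `((ST)^kρ)(B − ∂λ) = ((ST)^kρ)(B)` for every gauge-invariant density `ρ`, every level-`k` `λ` and every lattice
factor), whence by (1.19) `⟨B − ∂λ, Δ_k(B − ∂λ)⟩ = ⟨B, Δ_kB⟩` (`dotProduct_DeltaK_gaugeShift`), `Δ_k∂λ = 0` (`DeltaK_mulVec_grad`) and
`⟨∂λ, Δ_kB⟩ = 0` (`grad_dotProduct_DeltaK_mulVec`).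
-/

open scoped BigOperators NNReal RealInnerProductSpace

namespace Literature.MathematicalPhysics.QuantumFieldTheory.Balaban1983to89

namespace B5Eq119GaussianV1

open LatticeFieldCalculus MeasureTheory Matrix B5Eq112RenormTransf B5Eq117CompositionV1
open B9Eq3166 (subInt subInt_const_mul)
open B9Eq3170 (IsBasisOf gram_det_pos_of_injective)
open Literature.MathematicalPhysics.QuantumFieldTheory.BalabanImbrieJaffe1984to88.BIJ85AxialPropagator411
  (constraint411 mem_constraint411 PlaqSpace BondSpace toE curlOp half_norm_curlOp_sq formOp formInv formOp_formInv gaussian_source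
    partition_pos)
open Literature.MathematicalPhysics.QuantumFieldTheory.BalabanImbrieJaffe1984to88.BIJ85NoZeroModes309Torus (hD_holds)

noncomputable section

variable {P : Params}

/-! ## 1. The linear data of the Gaussian: the section, the fibre directions, their curvatures, `W_k` and `Δ_k` -/

section LinearData

/-- The iterated section `faceFieldIter k` (a right inverse of `Q_k` with all intermediate averages axial) AS A LINEAR MAP
(`faceFieldIter_add`/`_smul`). [cite: Balaban1984PropagatorsI, (1.17) p.20] -/
def faceFieldIterLin (P : Params) (k : ℕ) : VecField P k ℝ →ₗ[ℝ] VecField P 0 ℝ where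
  toFun := faceFieldIter k
  map_add' := faceFieldIter_add k
  map_smul' := faceFieldIter_smul k

/-- `faceFieldIterLin` is `faceFieldIter`. [cite: Balaban1984PropagatorsI, (1.17) p.20] -/
@[simp] theorem faceFieldIterLin_apply (k : ℕ) (B : VecField P k ℝ) : faceFieldIterLin P k B = faceFieldIter k B := rfl

/-- The section vanishes at `B = 0`. [cite: Balaban1984PropagatorsI, (1.17) p.20] -/
theorem faceFieldIter_map_zero (k : ℕ) : faceFieldIter k (0 : VecField P k ℝ) = 0 :=
  (faceFieldIterLin P k).map_zero

/-- Euclidean coordinates `u` of the null space `{Q_kA = 0, δ_Ax(Q_{k−1}A)⋯δ_Ax(A)}` of the `k`-fold constraints (the integration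
variables of (1.17), `A = faceFieldIter k B + N_k u`). [cite: Balaban1984PropagatorsI, (1.17) p.20] -/
abbrev KerCoord (P : Params) (k : ℕ) : Type := EuclideanSpace ℝ (Fin (kerDimIter P k))

/-- `u ↦ N_k u`: the coordinates as bond fields (columns of the basis matrix `kerBasisIter`). [cite: Balaban1984PropagatorsI, (1.17) p.20] -/
def kerEmb (P : Params) (k : ℕ) : KerCoord P k →ₗ[ℝ] VecField P 0 ℝ :=
  (kerBasisIter P k).mulVecLin ∘ₗ (WithLp.linearEquiv 2 ℝ (Fin (kerDimIter P k) → ℝ)).toLinearMap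

/-- `kerEmb u = N_k u`. [cite: Balaban1984PropagatorsI, (1.17) p.20] -/
theorem kerEmb_apply (k : ℕ) (u : KerCoord P k) : kerEmb P k u = kerBasisIter P k *ᵥ WithLp.ofLp u := rfl

/-- `N_k u` satisfies the `k`-fold constraints. [cite: Balaban1984PropagatorsI, (1.17) p.20] -/
theorem kerEmb_mem (k : ℕ) (u : KerCoord P k) : kerEmb P k u ∈ (constraint411 k : Submodule ℝ (VecField P 0 ℝ)) := by
  rw [kerEmb_apply, ← SetLike.mem_coe]
  exact ((isBasisOf_kerBasisIter (P := P) k).mem_iff _).mpr ⟨_, rfl⟩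

/-- `u ↦ N_k u` is injective (a basis). [cite: Balaban1984PropagatorsI, (1.17) p.20] -/
theorem kerEmb_injective (k : ℕ) : Function.Injective (kerEmb P k) := by
  intro u v h
  rw [kerEmb_apply, kerEmb_apply] at h
  have h1 : WithLp.ofLp u = WithLp.ofLp v := (isBasisOf_kerBasisIter (P := P) k).inj h
  have h2 := congrArg (WithLp.toLp 2) h1
  simpa using h2

/-- **`S_k`**: the curvature `u ↦ √w·∂(N_k u)` of the fibre directions, into the Euclidean plaquette space (the quadratic part of the
exponent of (1.17) in the integration variables; torus twin: `B5Eq114Gauss.Tk` on `N`). [cite: Balaban1984PropagatorsI, (1.19) p.20] -/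
def curlCoord (P : Params) (k : ℕ) (w c : ℝ) : KerCoord P k →ₗ[ℝ] PlaqSpace P :=
  curlOp (P := P) w c ∘ₗ (toE P).toLinearMap ∘ₗ kerEmb P k

/-- `S_k u = √w·∂(N_k u)` as a vector. [cite: Balaban1984PropagatorsI, (1.19) p.20] -/
theorem curlCoord_apply (k : ℕ) (w c : ℝ) (u : KerCoord P k) :
    curlCoord P k w c u = curlOp (P := P) w c (toE P (kerEmb P k u)) := rfl

/-- `(S_k u)(p) = √w·(∂(N_k u))(p)`. [cite: Balaban1984PropagatorsI, (1.19) p.20] -/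
theorem curlCoord_apply_plaq (k : ℕ) (w c : ℝ) (u : KerCoord P k) (p : Plaq P 0) :
    curlCoord P k w c u p = Real.sqrt w * curl c (kerEmb P k u) p := by
  rw [curlCoord_apply,
    show curlOp (P := P) w c (toE P (kerEmb P k u)) p = Real.sqrt w * curl c ((toE P).symm (toE P (kerEmb P k u))) p from rfl,
    LinearEquiv.symm_apply_apply]

/-- **`S_k` HAS NO ZERO MODES** (p. 19: "the quadratic form `⟨∂A, ∂A⟩` is positive on the subspace of `A` satisfying `QA = 0`,
`A(Γ_{y,x}) = 0`"; for all `k` by `BIJ85NoZeroModes309Torus.hD_holds`). [cite: Balaban1984PropagatorsI, (1.14) p.19] -/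
theorem curlCoord_injective {k : ℕ} (hk : k ≤ P.m + P.K) {w : ℝ} (hw : 0 < w) {c : ℝ} (hc : c ≠ 0) :
    Function.Injective (curlCoord P k w c) := by
  rw [← LinearMap.ker_eq_bot, LinearMap.ker_eq_bot']
  intro u hu
  have hcurl : ∀ p, curl c (kerEmb P k u) p = 0 := by
    intro p
    have h := congrArg (fun v : PlaqSpace P => v p) hu
    simp only [curlCoord_apply_plaq] at h
    have hsw : Real.sqrt w ≠ 0 := (Real.sqrt_pos.2 hw).ne'
    simpa [hsw] using h
  have h0 : kerEmb P k u = 0 := hD_holds hk hc _ (kerEmb_mem k u) hcurl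
  exact kerEmb_injective k (by rw [h0, map_zero])

/-- **`s_k`**: the curvature `B ↦ √w·∂(faceFieldIter k B)` of the section, linear in `B` (torus twin: `B5Eq114Gauss.Tk ∘ secK`).
[cite: Balaban1984PropagatorsI, (1.19) p.20] -/
def secCurl (P : Params) (k : ℕ) (w c : ℝ) : VecField P k ℝ →ₗ[ℝ] PlaqSpace P :=
  curlOp (P := P) w c ∘ₗ (toE P).toLinearMap ∘ₗ faceFieldIterLin P k

/-- `s_k(B) = √w·∂(faceFieldIter k B)`. [cite: Balaban1984PropagatorsI, (1.19) p.20] -/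
theorem secCurl_apply (k : ℕ) (w c : ℝ) (B : VecField P k ℝ) :
    secCurl P k w c B = curlOp (P := P) w c (toE P (faceFieldIter k B)) := rfl

/-- **`R_k`**: the orthogonal projection of the plaquette space onto the curvatures `S_k(KerCoord)` of the fibre directions (torus twin:
`B5Eq114Gauss.Rim`). [cite: Balaban1984PropagatorsI, (1.19) p.20] -/
def projK (P : Params) (k : ℕ) (w c : ℝ) : PlaqSpace P →L[ℝ] PlaqSpace P :=
  (LinearMap.range (curlCoord P k w c)).starProjection

/-- **`W_k = (1 − R_k)s_k`** (torus twin: `B5Eq114Gauss.Wk`). [cite: Balaban1984PropagatorsI, (1.19) p.20] -/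
def wOp (P : Params) (k : ℕ) (w c : ℝ) : VecField P k ℝ →ₗ[ℝ] PlaqSpace P :=
  secCurl P k w c - (projK P k w c).toLinearMap ∘ₗ secCurl P k w c

/-- `W_kB = s_k(B) − R_k s_k(B)`. [cite: Balaban1984PropagatorsI, (1.19) p.20] -/
theorem wOp_apply (k : ℕ) (w c : ℝ) (B : VecField P k ℝ) :
    wOp P k w c B = secCurl P k w c B - projK P k w c (secCurl P k w c B) := rfl

/-- **`Δ_k = W_k^†W_k`** as a real MATRIX on the level-`k` bonds: the Gram matrix `(Δ_k)_{bb'} = ⟨W_k e_b, W_k e_{b'}⟩` of `W_k` in the bond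
basis `e_b` (torus twin: `B5Eq114Gauss.DeltaK`). [cite: Balaban1984PropagatorsI, (1.19) p.20] -/
def DeltaK (P : Params) (k : ℕ) (w c : ℝ) : Matrix (PBond P k) (PBond P k) ℝ :=
  Matrix.of fun b b' => ⟪wOp P k w c (Pi.basisFun ℝ (PBond P k) b), wOp P k w c (Pi.basisFun ℝ (PBond P k) b')⟫

/-- `Δ_k` is symmetric. [cite: Balaban1984PropagatorsI, (1.19) p.20] -/
theorem DeltaK_isSymm (k : ℕ) (w c : ℝ) : (DeltaK P k w c).IsSymm :=
  Matrix.IsSymm.ext fun b b' => by simp only [DeltaK, Matrix.of_apply]; exact real_inner_comm _ _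

/-- `W_kB = Σ_b B(b)·W_k e_b`. [cite: Balaban1984PropagatorsI, (1.19) p.20] -/
theorem wOp_eq_sum (k : ℕ) (w c : ℝ) (B : VecField P k ℝ) :
    wOp P k w c B = ∑ b : PBond P k, B b • wOp P k w c (Pi.basisFun ℝ (PBond P k) b) := by
  conv_lhs => rw [← (Pi.basisFun ℝ (PBond P k)).sum_repr B]
  simp only [map_sum, map_smul, Pi.basisFun_repr]

/-- **`⟨B, Δ_kB'⟩ = ⟨W_kB, W_kB'⟩`** (`⟨·,·⟩` on the left = the unit-lattice pairing of level-`k` bond fields). [cite: Balaban1984PropagatorsI, (1.19) p.20] -/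
theorem dotProduct_DeltaK_mulVec (k : ℕ) (w c : ℝ) (B B' : VecField P k ℝ) :
    B ⬝ᵥ (DeltaK P k w c *ᵥ B') = ⟪wOp P k w c B, wOp P k w c B'⟫ := by
  rw [wOp_eq_sum k w c B, wOp_eq_sum k w c B', sum_inner]
  simp only [dotProduct, mulVec, DeltaK, Matrix.of_apply, inner_sum, real_inner_smul_left, real_inner_smul_right, Finset.mul_sum]
  refine Finset.sum_congr rfl fun b _ => Finset.sum_congr rfl fun b' _ => ?_
  ring

/-- **`⟨B, Δ_kB⟩ = ‖W_kB‖²`** (torus twin: `B5Eq114Gauss.inner_DeltaK`). [cite: Balaban1984PropagatorsI, (1.19) p.20] -/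
theorem dotProduct_DeltaK_mulVec_self (k : ℕ) (w c : ℝ) (B : VecField P k ℝ) :
    B ⬝ᵥ (DeltaK P k w c *ᵥ B) = ‖wOp P k w c B‖ ^ 2 := by
  rw [dotProduct_DeltaK_mulVec, real_inner_self_eq_norm_sq]

/-- `Δ_k ≥ 0`. [cite: Balaban1984PropagatorsI, (1.19) p.20] -/
theorem DeltaK_nonneg (k : ℕ) (w c : ℝ) (B : VecField P k ℝ) : 0 ≤ B ⬝ᵥ (DeltaK P k w c *ᵥ B) := by
  rw [dotProduct_DeltaK_mulVec_self]; positivity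

end LinearData

/-! ## 2. "Obviously a Gaussian integral": the `k`-fold fibre integral of `e^{−S}` in closed form -/

section FibreGauss

variable {k : ℕ} {w c : ℝ}

/-- THE EXPONENT ON THE FIBRE: `S(faceFieldIter k B + N_k u) = ½‖S_k u + s_k(B)‖²`. [cite: Balaban1984PropagatorsI, (1.14) p.19] -/
theorem curlAction_fibre (hw : 0 ≤ w) (c : ℝ) (k : ℕ) (B : VecField P k ℝ) (u : KerCoord P k) :
    curlAction w c (faceFieldIter k B + kerBasisIter P k *ᵥ WithLp.ofLp u) =
      (1 / 2) * ‖curlCoord P k w c u + secCurl P k w c B‖ ^ 2 := by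
  have h1 : curlCoord P k w c u + secCurl P k w c B = curlOp (P := P) w c (toE P (faceFieldIter k B + kerEmb P k u)) := by
    rw [curlCoord_apply, secCurl_apply, ← map_add, ← map_add, add_comm]
  rw [h1, half_norm_curlOp_sq hw, LinearEquiv.symm_apply_apply, kerEmb_apply]

/-- LEAST SQUARES: the orthogonal projection onto the fibre curvatures is `R_k s = S_k(S_k^*S_k)⁻¹S_k^* s` (no zero modes).
[cite: Balaban1984PropagatorsI, (1.14) p.19] -/
theorem projK_apply_eq (hk : k ≤ P.m + P.K) (hw : 0 < w) (hc : c ≠ 0) (s : PlaqSpace P) :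
    projK P k w c s =
      curlCoord P k w c (formInv (curlCoord P k w c) (LinearMap.adjoint (curlCoord P k w c) s)) := by
  have hS := curlCoord_injective (P := P) hk hw hc
  have h2 : ∀ v : KerCoord P k,
      ⟪curlCoord P k w c (formInv (curlCoord P k w c) (LinearMap.adjoint (curlCoord P k w c) s)), curlCoord P k w c v⟫ =
        ⟪LinearMap.adjoint (curlCoord P k w c) s, v⟫ := by
    intro v
    rw [← LinearMap.adjoint_inner_left (curlCoord P k w c) v, ← LinearMap.comp_apply (LinearMap.adjoint (curlCoord P k w c))]
    have : (LinearMap.adjoint (curlCoord P k w c) ∘ₗ curlCoord P k w c)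
        (formInv (curlCoord P k w c) (LinearMap.adjoint (curlCoord P k w c) s)) = LinearMap.adjoint (curlCoord P k w c) s :=
      formOp_formInv hS _
    rw [this]
  unfold projK
  refine Submodule.eq_starProjection_of_mem_of_inner_eq_zero (LinearMap.mem_range_self _ _) fun y hy => ?_
  obtain ⟨v, rfl⟩ := LinearMap.mem_range.1 hy
  rw [inner_sub_left, h2 v, ← LinearMap.adjoint_inner_left (curlCoord P k w c) v s, sub_self]

/-- `‖W_kB‖² = ‖s_k(B)‖² − ⟨S_k^*s_k(B), (S_k^*S_k)⁻¹S_k^*s_k(B)⟩` — the exponent left after completing the square.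
[cite: Balaban1984PropagatorsI, (1.14) p.19] -/
theorem norm_wOp_sq (hk : k ≤ P.m + P.K) (hw : 0 < w) (hc : c ≠ 0) (B : VecField P k ℝ) :
    ‖wOp P k w c B‖ ^ 2 = ‖secCurl P k w c B‖ ^ 2 -
      ⟪LinearMap.adjoint (curlCoord P k w c) (secCurl P k w c B),
        formInv (curlCoord P k w c) (LinearMap.adjoint (curlCoord P k w c) (secCurl P k w c B))⟫ := by
  have hS := curlCoord_injective (P := P) hk hw hc
  have h1 : ⟪secCurl P k w c B,
      curlCoord P k w c (formInv (curlCoord P k w c) (LinearMap.adjoint (curlCoord P k w c) (secCurl P k w c B)))⟫ =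
        ⟪LinearMap.adjoint (curlCoord P k w c) (secCurl P k w c B),
          formInv (curlCoord P k w c) (LinearMap.adjoint (curlCoord P k w c) (secCurl P k w c B))⟫ :=
    (LinearMap.adjoint_inner_left (curlCoord P k w c) _ _).symm
  have h2 : ‖curlCoord P k w c (formInv (curlCoord P k w c) (LinearMap.adjoint (curlCoord P k w c) (secCurl P k w c B)))‖ ^ 2 =
      ⟪LinearMap.adjoint (curlCoord P k w c) (secCurl P k w c B),
        formInv (curlCoord P k w c) (LinearMap.adjoint (curlCoord P k w c) (secCurl P k w c B))⟫ := by
    rw [← real_inner_self_eq_norm_sq, ← LinearMap.adjoint_inner_left (curlCoord P k w c),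
      ← LinearMap.comp_apply (LinearMap.adjoint (curlCoord P k w c))]
    have : (LinearMap.adjoint (curlCoord P k w c) ∘ₗ curlCoord P k w c)
        (formInv (curlCoord P k w c) (LinearMap.adjoint (curlCoord P k w c) (secCurl P k w c B))) =
          LinearMap.adjoint (curlCoord P k w c) (secCurl P k w c B) :=
      formOp_formInv hS _
    rw [this, real_inner_comm]
  rw [wOp_apply, projK_apply_eq hk hw hc, norm_sub_sq_real, h1, h2]
  ring

/-- **THE FIBRE GAUSSIAN IN CLOSED FORM**: `∫du e^{−S(faceFieldIter k B + N_k u)} = (∫dv e^{−½‖S_kv‖²})·exp(−½‖W_kB‖²)` (completing the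
square, `BIJ85AxialPropagator411.gaussian_source`, then least squares). [cite: Balaban1984PropagatorsI, (1.14) p.19] -/
theorem integral_fibre_gauss (hk : k ≤ P.m + P.K) (hw : 0 < w) (hc : c ≠ 0) (B : VecField P k ℝ) :
    ∫ u : Fin (kerDimIter P k) → ℝ, Real.exp (-curlAction w c (faceFieldIter k B + kerBasisIter P k *ᵥ u)) =
      (∫ v : KerCoord P k, Real.exp (-(1 / 2) * ‖curlCoord P k w c v‖ ^ 2)) * Real.exp (-(1 / 2) * ‖wOp P k w c B‖ ^ 2) := by
  have hS := curlCoord_injective (P := P) hk hw hc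
  -- (i) Euclidean coordinates (the identification `Fin n → ℝ ≃ EuclideanSpace` preserves the volume)
  have htransfer : ∫ u : Fin (kerDimIter P k) → ℝ, Real.exp (-curlAction w c (faceFieldIter k B + kerBasisIter P k *ᵥ u)) =
      ∫ v : KerCoord P k, Real.exp (-curlAction w c (faceFieldIter k B + kerBasisIter P k *ᵥ WithLp.ofLp v)) := by
    rw [← (EuclideanSpace.volume_preserving_symm_measurableEquiv_toLp (Fin (kerDimIter P k))).integral_comp']
    rfl
  -- (ii) complete the square against the source `b = −S_k^* s_k(B)`
  have hsq : ∀ v : KerCoord P k, Real.exp (-curlAction w c (faceFieldIter k B + kerBasisIter P k *ᵥ WithLp.ofLp v)) =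
      Real.exp (-(1 / 2) * ‖secCurl P k w c B‖ ^ 2) *
        Real.exp (-(1 / 2) * ‖curlCoord P k w c v‖ ^ 2 + ⟪v, -(LinearMap.adjoint (curlCoord P k w c) (secCurl P k w c B))⟫) := by
    intro v
    rw [curlAction_fibre hw.le, ← Real.exp_add, norm_add_sq_real, inner_neg_right, LinearMap.adjoint_inner_right]
    congr 1
    ring
  rw [htransfer]
  simp_rw [hsq]
  rw [integral_const_mul, gaussian_source hS, norm_wOp_sq hk hw hc B, map_neg, inner_neg_neg, ← mul_assoc, ← Real.exp_add,
    mul_comm]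
  congr 2
  ring

/-- **THE RIGHT-HAND SIDE OF (1.17) IS A GAUSSIAN**: `∫dA δ(B − Q_kA)δ_Ax(Q_{k−1}A)⋯δ_Ax(A)e^{−S(A)} = (its value at B = 0)·exp(−½‖W_kB‖²)`
(torus twin: `B5Eq114Gauss.rt17_gauss`). [cite: Balaban1984PropagatorsI, (1.19) p.20] -/
theorem multiRT_gauss (hk : k ≤ P.m + P.K) (hw : 0 < w) (hc : c ≠ 0) (B : VecField P k ℝ) :
    multiRT k (fun A => Real.exp (-curlAction w c A)) B =
      multiRT k (fun A => Real.exp (-curlAction w c A)) (0 : VecField P k ℝ) * Real.exp (-(1 / 2) * ‖wOp P k w c B‖ ^ 2) := by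
  simp only [multiRT, subInt]
  rw [integral_fibre_gauss hk hw hc B, integral_fibre_gauss hk hw hc 0, map_zero, norm_zero]
  ring_nf
  simp

/-- The Gaussian constant is positive: `∫dA δ(−Q_kA)δ_Ax⋯δ_Ax(A)e^{−S(A)} > 0`. [cite: Balaban1984PropagatorsI, (1.19) p.20] -/
theorem multiRT_gauss_zero_pos (hk : k ≤ P.m + P.K) (hw : 0 < w) (hc : c ≠ 0) :
    0 < multiRT k (fun A => Real.exp (-curlAction w c A)) (0 : VecField P k ℝ) := by
  simp only [multiRT, subInt]
  rw [integral_fibre_gauss hk hw hc 0, map_zero, norm_zero]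
  refine mul_pos (Real.sqrt_pos.2 (gram_det_pos_of_injective _ (isBasisOf_kerBasisIter (P := P) k).inj))
    (mul_pos (partition_pos (curlCoord_injective (P := P) hk hw hc)) (Real.exp_pos _))

end FibreGauss

/-! ## 3. (1.19), (1.14) and `Z_{k,Ax} = Z^{(k−1)}⋯Z^{(0)}` -/

section Eq119

variable {k : ℕ} {w c : ℝ}

/-- **`Z_{k,Ax}`** := `((ST)^k e^{−S})(0)`, the value of the iterated transformation at `B = 0` (what (1.19) gives at `B = 0`, the exponential
factor being `1` there). [cite: Balaban1984PropagatorsI, (1.19) p.20] -/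
def zAx (P : Params) (k : ℕ) (w c : ℝ) : ℝ :=
  rtPow k (fun A : VecField P 0 ℝ => Real.exp (-curlAction w c A)) 0

/-- **(1.19)** p. 20 [PDF 4], verbatim: *"We define `((ST)^k e^{−S})(B) = Z_{k,Ax} exp(−½⟨B, Δ_kB⟩)`. (1.19)"* — PROVED with the explicit
symmetric `Δ_k = W_k^†W_k` (`DeltaK`) and `Z_{k,Ax} = ((ST)^k e^{−S})(0)` (`zAx`), for the abelian action `S = ½Σ_p w|(∂A)(p)|²` (`w > 0`, lattice
factor `c ≠ 0`), every `k ≤ m + K` and EVERY level-`k` field `B`. [cite: Balaban1984PropagatorsI, (1.19) p.20] -/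
theorem eq119 (hk : k ≤ P.m + P.K) (hw : 0 < w) (hc : c ≠ 0) (B : VecField P k ℝ) :
    rtPow k (fun A => Real.exp (-curlAction w c A)) B =
      zAx P k w c * Real.exp (-(1 / 2) * (B ⬝ᵥ (DeltaK P k w c *ᵥ B))) := by
  obtain ⟨z, _, h⟩ := eq117_curlAction (P := P) hk hw hc
  rw [zAx, h B, h 0, multiRT_gauss hk hw hc B, dotProduct_DeltaK_mulVec_self, mul_assoc]

/-- **`Z_{k,Ax} > 0`** (torus twin: `B5Eq114Gauss.Zk_pos`). [cite: Balaban1984PropagatorsI, (1.19) p.20] -/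
theorem zAx_pos (hk : k ≤ P.m + P.K) (hw : 0 < w) (hc : c ≠ 0) : 0 < zAx P k w c := by
  obtain ⟨z, hz, h⟩ := eq117_curlAction (P := P) hk hw hc
  rw [zAx, h 0]
  exact mul_pos hz (multiRT_gauss_zero_pos hk hw hc)

/-- **(1.19) in the printed shape**: `(ST)^k e^{−S}` IS a centred Gaussian density — some `Z_{k,Ax} > 0` and some symmetric `Δ_k` with
`((ST)^k e^{−S})(B) = Z_{k,Ax}exp(−½⟨B, Δ_kB⟩)` for all `B`. [cite: Balaban1984PropagatorsI, (1.19) p.20] -/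
theorem eq119_exists (hk : k ≤ P.m + P.K) (hw : 0 < w) (hc : c ≠ 0) :
    ∃ Z : ℝ, 0 < Z ∧ ∃ Δ : Matrix (PBond P k) (PBond P k) ℝ, Δ.IsSymm ∧ (∀ B : VecField P k ℝ, 0 ≤ B ⬝ᵥ (Δ *ᵥ B)) ∧
      ∀ B : VecField P k ℝ, rtPow k (fun A => Real.exp (-curlAction w c A)) B = Z * Real.exp (-(1 / 2) * (B ⬝ᵥ (Δ *ᵥ B))) :=
  ⟨zAx P k w c, zAx_pos hk hw hc, DeltaK P k w c, DeltaK_isSymm k w c, DeltaK_nonneg k w c, eq119 hk hw hc⟩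

/-- **(1.14)** p. 19 [PDF 3], verbatim: *"A result of the integration is obviously a Gaussian density
`(Te^{−S})(B) = Z^{(0)} exp(−½⟨B, Δ₁B⟩) = Z^{(0)} exp(−S₁(B))`. (1.14)"* — for the transformation OF RECORD `B5Eq112RenormTransf.renormTransf`
applied to the abelian action: `Δ₁ = DeltaK P 1`, `Z^{(0)} = zAx P 1 = (Te^{−S})(0)` (torus twin: `B5Eq114Gauss.eq114_holds`).
[cite: Balaban1984PropagatorsI, (1.14) p.19] -/
theorem eq114 (h1 : 1 ≤ P.m + P.K) (hw : 0 < w) (hc : c ≠ 0) (B : VecField P 1 ℝ) :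
    renormTransf (curlAction w c) B = zAx P 1 w c * Real.exp (-(1 / 2) * (B ⬝ᵥ (DeltaK P 1 w c *ᵥ B))) :=
  eq119 h1 hw hc B

/-- **(1.14) in the printed shape** (the typed claim of the torus row `B5SectBStatements.Eq114`, here for `renormTransf`): some `Z^{(0)} > 0` and
some symmetric `Δ₁ ≥ 0` with `(Te^{−S})(B) = Z^{(0)}exp(−½⟨B, Δ₁B⟩)` for all `B`. [cite: Balaban1984PropagatorsI, (1.14) p.19] -/
theorem eq114_exists (h1 : 1 ≤ P.m + P.K) (hw : 0 < w) (hc : c ≠ 0) :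
    ∃ Z : ℝ, 0 < Z ∧ ∃ Δ : Matrix (PBond P 1) (PBond P 1) ℝ, Δ.IsSymm ∧ (∀ B : VecField P 1 ℝ, 0 ≤ B ⬝ᵥ (Δ *ᵥ B)) ∧
      ∀ B : VecField P 1 ℝ, renormTransf (curlAction w c) B = Z * Real.exp (-(1 / 2) * (B ⬝ᵥ (Δ *ᵥ B))) :=
  eq119_exists h1 hw hc

/-- `Z_{0,Ax} = 1` (`(ST)^0 = id`, `S(0) = 0`). [cite: Balaban1984PropagatorsI, (1.19) p.20] -/
theorem zAx_zero (w c : ℝ) : zAx P 0 w c = 1 := by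
  rw [zAx, rtPow_zero]
  simp [curlAction, curl]

/-- Level `0` consistency: `⟨B, Δ₀B⟩ = 2S(B)` (`(ST)^0 e^{−S} = e^{−S}` is its own Gaussian form). [cite: Balaban1984PropagatorsI, (1.19) p.20] -/
theorem dotProduct_DeltaK_zero (hw : 0 < w) (hc : c ≠ 0) (B : VecField P 0 ℝ) :
    B ⬝ᵥ (DeltaK P 0 w c *ᵥ B) = 2 * curlAction w c B := by
  have h := eq119 (k := 0) (Nat.zero_le _) hw hc B
  rw [rtPow_zero, zAx_zero, one_mul] at h
  have := Real.exp_injective h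
  linarith

/-- Constants come out of the one-step transformation. [cite: Balaban1984PropagatorsI, (1.12) p.19] -/
theorem rtDensity_const_mul {j : ℕ} (a : ℝ) (ρ : VecField P j ℝ → ℝ) (B : VecField P (j + 1) ℝ) :
    rtDensity (fun A => a * ρ A) B = a * rtDensity ρ B :=
  subInt_const_mul _ a _

/-- **`Z^{(k)}`** := `((ST)e^{−½⟨·, Δ_k·⟩})(0)` — "the normalization factor connected with `k + 1` integration" (the constant of the one-step
transformation applied to the level-`k` Gaussian). [cite: Balaban1984PropagatorsI, (1.19) p.20] -/
def zFactor (P : Params) (k : ℕ) (w c : ℝ) : ℝ :=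
  rtDensity (fun A : VecField P k ℝ => Real.exp (-(1 / 2) * (A ⬝ᵥ (DeltaK P k w c *ᵥ A)))) 0

/-- `(ST)^{k+1}e^{−S} = Z_{k,Ax}·(ST)(e^{−½⟨·,Δ_k·⟩})` (one more step applied to (1.19) at level `k`). [cite: Balaban1984PropagatorsI, (1.19) p.20] -/
theorem rtPow_succ_gauss (hk : k ≤ P.m + P.K) (hw : 0 < w) (hc : c ≠ 0) (C : VecField P (k + 1) ℝ) :
    rtPow (k + 1) (fun A => Real.exp (-curlAction w c A)) C =
      zAx P k w c * rtDensity (fun A : VecField P k ℝ => Real.exp (-(1 / 2) * (A ⬝ᵥ (DeltaK P k w c *ᵥ A)))) C := by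
  have hfun : rtPow k (fun A : VecField P 0 ℝ => Real.exp (-curlAction w c A)) =
      fun A => zAx P k w c * Real.exp (-(1 / 2) * (A ⬝ᵥ (DeltaK P k w c *ᵥ A))) := funext (eq119 hk hw hc)
  rw [rtPow_succ, hfun, rtDensity_const_mul]

/-- **`Z_{k+1,Ax} = Z^{(k)}·Z_{k,Ax}`**. [cite: Balaban1984PropagatorsI, (1.19) p.20] -/
theorem zAx_succ (hk : k + 1 ≤ P.m + P.K) (hw : 0 < w) (hc : c ≠ 0) :
    zAx P (k + 1) w c = zFactor P k w c * zAx P k w c := by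
  have h := rtPow_succ_gauss (Nat.le_of_succ_le hk) hw hc (0 : VecField P (k + 1) ℝ)
  rw [show rtPow (k + 1) (fun A : VecField P 0 ℝ => Real.exp (-curlAction w c A)) 0 = zAx P (k + 1) w c from rfl] at h
  rw [h, zFactor, mul_comm]

/-- **THE ONE-STEP GAUSSIAN RECURSION** behind "`Z^{(j)}` … connected with `j + 1` integration": `((ST)e^{−½⟨·,Δ_k·⟩})(B) = Z^{(k)}exp(−½⟨B, Δ_{k+1}B⟩)`
for every `B`. [cite: Balaban1984PropagatorsI, (1.19) p.20] -/
theorem eq119_step (hk : k + 1 ≤ P.m + P.K) (hw : 0 < w) (hc : c ≠ 0) (B : VecField P (k + 1) ℝ) :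
    rtDensity (fun A : VecField P k ℝ => Real.exp (-(1 / 2) * (A ⬝ᵥ (DeltaK P k w c *ᵥ A)))) B =
      zFactor P k w c * Real.exp (-(1 / 2) * (B ⬝ᵥ (DeltaK P (k + 1) w c *ᵥ B))) := by
  have hk' : k ≤ P.m + P.K := Nat.le_of_succ_le hk
  have hpos := zAx_pos (P := P) hk' hw hc
  have hB := rtPow_succ_gauss hk' hw hc B
  rw [eq119 hk hw hc B, zAx_succ hk hw hc] at hB
  apply mul_left_cancel₀ hpos.ne'
  rw [← hB]
  ring

/-- `Z^{(k)} > 0`. [cite: Balaban1984PropagatorsI, (1.19) p.20] -/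
theorem zFactor_pos (hk : k + 1 ≤ P.m + P.K) (hw : 0 < w) (hc : c ≠ 0) : 0 < zFactor P k w c := by
  have h1 := zAx_pos (P := P) hk hw hc
  rw [zAx_succ hk hw hc] at h1
  exact (pos_iff_pos_of_mul_pos h1).2 (zAx_pos (Nat.le_of_succ_le hk) hw hc)

/-- **"It is easily seen that `Z_{k,Ax} = Z^{(k−1)}·…·Z^{(0)}`"** p. 20, PROVED. [cite: Balaban1984PropagatorsI, (1.19) p.20] -/
theorem zAx_eq_prod : ∀ {k : ℕ}, k ≤ P.m + P.K → ∀ {w : ℝ}, 0 < w → ∀ {c : ℝ}, c ≠ 0 →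
    zAx P k w c = ∏ j ∈ Finset.range k, zFactor P j w c
  | 0, _, w, _, c, _ => by rw [zAx_zero, Finset.prod_range_zero]
  | k + 1, hk, _, hw, _, hc => by
    rw [zAx_succ hk hw hc, zAx_eq_prod (Nat.le_of_succ_le hk) hw hc, Finset.prod_range_succ, mul_comm]

/-- `Z^{(0)}` of (1.14) is the first factor: `zAx P 1 = zFactor P 0 = (Te^{−S})(0)`. [cite: Balaban1984PropagatorsI, (1.14) p.19] -/
theorem zAx_one (h1 : 1 ≤ P.m + P.K) (hw : 0 < w) (hc : c ≠ 0) : zAx P 1 w c = zFactor P 0 w c := by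
  rw [zAx_eq_prod h1 hw hc, Finset.prod_range_one]

end Eq119

/-! ## 4. v1.1 (append-only): (1.15) ITERATED — "the form `⟨B, Δ_kB⟩` is gauge invariant", for every `k` -/

section GaugeInvariance

variable {j k : ℕ} {w c : ℝ}

/-- REPRESENTATIVE INDEPENDENCE of the one-step transformation in density form: the fibre integral `(Tρ)(B)` may be based at ANY point `A₀` of
the fibre `{A axial, QA = B}` (`B5Eq112RenormTransf.renormTransf_eq_of_mem_fibre` for densities). [cite: Balaban1984PropagatorsI, (1.12) p.19] -/
theorem rtDensity_eq_of_mem_fibre (hj : j + 1 ≤ P.m + P.K) (ρ : VecField P j ℝ → ℝ) {B : VecField P (j + 1) ℝ}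
    {A₀ : VecField P j ℝ} (h₀ : A₀ ∈ fibre B) :
    rtDensity ρ B = subInt (kerBasisMatrix P j) (fun A' => ρ (A₀ + A')) := by
  have hmem : A₀ - faceField B ∈ (axialKer P j ℝ : Set (VecField P j ℝ)) := (mem_fibre_iff hj B A₀).mp h₀
  obtain ⟨z₀, hz₀⟩ := (isBasisOf_kerBasisMatrix.mem_iff _).mp hmem
  unfold rtDensity subInt
  congr 1
  have hfun : (fun z : Fin (kerDim P j) → ℝ => ρ (A₀ + kerBasisMatrix P j *ᵥ z))
      = fun z => ρ (faceField B + kerBasisMatrix P j *ᵥ (z₀ + z)) := by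
    funext z
    rw [mulVec_add, hz₀]
    congr 1
    abel
  rw [hfun]
  exact (integral_add_left_eq_self (μ := volume)
    (fun z : Fin (kerDim P j) → ℝ => ρ (faceField B + kerBasisMatrix P j *ᵥ z)) z₀).symm

/-- **(1.15), ONE STEP, density form** p. 19 [PDF 3]: *"If `λ₁` is a gauge transformation on `T_L^{(1)}`, then defining `λ` on `T₁` as constant on
each block, `λ(x) = λ₁(y)` for `x ∈ B(y)`, we have `… = ∫dA δ(B^{λ₁} − QA^λ)δ_Ax(A^λ)exp(−S(A^λ)) = ∫dA δ(B − ∂λ₁ − QA + ∂Q′λ)δ_Ax(A)exp(−S(A)) = …`"* —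
for every density `ρ` invariant under the gauge transformations `A ↦ A − ∂λ` (lattice factor `c`) and every coarse `λ₁`: `(Tρ)(B − ∂λ₁) = (Tρ)(B)`
(coarse factor `c/L`); the printed change of variables (`B5Eq112RenormTransf.gaugeShift_mem_fibre`). [cite: Balaban1984PropagatorsI, (1.15) p.19] -/
theorem rtDensity_gaugeShift (hj : j + 1 ≤ P.m + P.K) {c : ℝ} {ρ : VecField P j ℝ → ℝ}
    (hρ : ∀ (lam : SiteField P j ℝ) (A : VecField P j ℝ), ρ (gaugeShift c lam A) = ρ A) (lam₁ : SiteField P (j + 1) ℝ)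
    (B : VecField P (j + 1) ℝ) :
    rtDensity ρ (gaugeShift (c / P.L) lam₁ B) = rtDensity ρ B := by
  rw [rtDensity_eq_of_mem_fibre hj ρ (gaugeShift_mem_fibre hj c lam₁ (faceField_mem_fibre hj B)), rtDensity]
  congr 1
  funext A'
  have h : gaugeShift c (blockConst lam₁) (faceField B) + A' = gaugeShift c (blockConst lam₁) (faceField B + A') := by
    funext b
    simp only [gaugeShift, Pi.add_apply]
    ring
  rw [h, hρ]

/-- **(1.15) ITERATED**: `((ST)^kρ)(B − ∂λ) = ((ST)^kρ)(B)` for every density `ρ` invariant under all gauge transformations (1.4) of the level-`0`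
fields, every level-`k` gauge function `λ` and every lattice factor (the chain (1.15) at each of the `k` steps; (1.20) `Q_kA^λ = Q_kA − ∂Q'_kλ`).
[cite: Balaban1984PropagatorsI, (1.15) p.19] -/
theorem rtPow_gaugeShift : ∀ {k : ℕ}, k ≤ P.m + P.K → ∀ {ρ : VecField P 0 ℝ → ℝ},
    (∀ (c : ℝ) (lam : SiteField P 0 ℝ) (A : VecField P 0 ℝ), ρ (gaugeShift c lam A) = ρ A) →
    ∀ (c : ℝ) (lam : SiteField P k ℝ) (B : VecField P k ℝ), rtPow k ρ (gaugeShift c lam B) = rtPow k ρ B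
  | 0, _, _, hρ, c, lam, B => by rw [rtPow_zero]; exact hρ c lam B
  | k + 1, hk, ρ, hρ, c, lam, B => by
    rw [rtPow_succ]
    have h := rtDensity_gaugeShift hk (c := c * P.L) (ρ := rtPow k ρ)
      (fun lam' A => rtPow_gaugeShift (Nat.le_of_succ_le hk) hρ (c * P.L) lam' A) lam B
    rwa [mul_div_cancel_right₀ _ (Nat.cast_ne_zero.2 P.L_pos.ne')] at h

/-- (1.15) iterated for the abelian action (1.3)/(1.5) (gauge invariant by `curlAction_gaugeShift`): `((ST)^k e^{−S})(B − ∂λ) = ((ST)^k e^{−S})(B)`.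
[cite: Balaban1984PropagatorsI, (1.15) p.19] -/
theorem rtPow_curlAction_gaugeShift (hk : k ≤ P.m + P.K) (w c₀ c : ℝ) (lam : SiteField P k ℝ) (B : VecField P k ℝ) :
    rtPow k (fun A => Real.exp (-curlAction w c₀ A)) (gaugeShift c lam B) = rtPow k (fun A => Real.exp (-curlAction w c₀ A)) B :=
  rtPow_gaugeShift hk (fun c' lam' A => by rw [curlAction_gaugeShift]) c lam B

/-- **"The form `⟨B, Δ_kB⟩` is gauge invariant"** (p. 19, after (1.14), for `Δ₁`; here for every `k`): `⟨B − ∂λ, Δ_k(B − ∂λ)⟩ = ⟨B, Δ_kB⟩` for every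
level-`k` gauge function `λ` and lattice factor `c'`. [cite: Balaban1984PropagatorsI, (1.15) p.19] -/
theorem dotProduct_DeltaK_gaugeShift (hk : k ≤ P.m + P.K) (hw : 0 < w) (hc : c ≠ 0) (c' : ℝ) (lam : SiteField P k ℝ)
    (B : VecField P k ℝ) :
    gaugeShift c' lam B ⬝ᵥ (DeltaK P k w c *ᵥ gaugeShift c' lam B) = B ⬝ᵥ (DeltaK P k w c *ᵥ B) := by
  have h := rtPow_curlAction_gaugeShift hk w c c' lam B
  rw [eq119 hk hw hc, eq119 hk hw hc] at h
  have h2 := mul_left_cancel₀ (zAx_pos hk hw hc).ne' h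
  have h3 := Real.exp_injective h2
  linarith

/-- `W_k` kills pure gauges: `W_k ∂λ = 0`. [cite: Balaban1984PropagatorsI, (1.15) p.19] -/
theorem wOp_grad (hk : k ≤ P.m + P.K) (hw : 0 < w) (hc : c ≠ 0) (c' : ℝ) (lam : SiteField P k ℝ) :
    wOp P k w c (grad c' lam) = 0 := by
  have h := dotProduct_DeltaK_gaugeShift hk hw hc c' lam (grad c' lam)
  rw [show gaugeShift c' lam (grad c' lam) = 0 from funext fun b => sub_self _, zero_dotProduct,
    dotProduct_DeltaK_mulVec_self] at h
  have h2 : ‖wOp P k w c (grad c' lam)‖ = 0 := by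
    have := sq_eq_zero_iff.1 h.symm
    exact this
  exact norm_eq_zero.1 h2

/-- **`Δ_k∂ = 0`**: the pure gauges `∂λ` are zero modes of `Δ_k` (gauge invariance of the form, polarised). [cite: Balaban1984PropagatorsI, (1.15) p.19] -/
theorem DeltaK_mulVec_grad (hk : k ≤ P.m + P.K) (hw : 0 < w) (hc : c ≠ 0) (c' : ℝ) (lam : SiteField P k ℝ) :
    DeltaK P k w c *ᵥ grad c' lam = 0 := by
  have h : ∀ B : VecField P k ℝ, B ⬝ᵥ (DeltaK P k w c *ᵥ grad c' lam) = 0 := fun B => by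
    rw [dotProduct_DeltaK_mulVec, wOp_grad hk hw hc, inner_zero_right]
  exact dotProduct_self_eq_zero.1 (h _)

/-- **`∂^*Δ_k = 0`**: `⟨∂λ, Δ_kB⟩ = 0` for every `B`. [cite: Balaban1984PropagatorsI, (1.15) p.19] -/
theorem grad_dotProduct_DeltaK_mulVec (hk : k ≤ P.m + P.K) (hw : 0 < w) (hc : c ≠ 0) (c' : ℝ) (lam : SiteField P k ℝ)
    (B : VecField P k ℝ) : grad c' lam ⬝ᵥ (DeltaK P k w c *ᵥ B) = 0 := by
  rw [dotProduct_DeltaK_mulVec, wOp_grad hk hw hc, inner_zero_left]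

end GaugeInvariance

end

end B5Eq119GaussianV1

end Literature.MathematicalPhysics.QuantumFieldTheory.Balaban1983to89
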